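import Literature.Analysis.InnerProduct.HigherLensSpaceGeneratingFunction
import Mathlib.Tactic.IntervalCases
import HarnessLib

/-!
# Ikeda–Yamamoto's Corollary 3.4 in every dimension: a HOMOGENEOUS lens space `L(q : p₀, …, p_n)` (`pᵢ ≡ ±p_j (mod q)`) is
# determined by its spectrum among lens spaces — the generating function `F(z) = ∑_k dim E_{k(k+2n)}z^k` has a pole of order
# exactly `n+1` at the `q`-th root of unity `γ^{−1}` iff the weights are pairwise `≡ ±`, with
# `lim_{z→γ^{−1}}(1 − γz)^{n+1}F(z) = (1/q)·#{l : lpᵢ ≡ ±1 ∀i}·(1 − γ^{−2})^{−n}`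

Layer `Literature/Analysis/InnerProduct`, namespace `Literature.Analysis.InnerProduct`; lane `lit-hodgefound`, prover seat
`lit-hodgefound-p06`, generation 44, self-proposed row g44-#11 — the every-dimension version of row g43-#5
(`LensSpaceHomogeneousSpectralRigidity.lean`, `n + 1 = 2`: `(1 − γz)²F(z)` at `γ^{−1}`), the sequel BY IMPORT of row g44-#7
(`HigherLensSpaceGeneratingFunction.lean`: THEOREM 3.2 as a function on the unit disc, `tsum_lensSpaceMultiplicity_mul_pow`, for EVERY `n`).
THEOREMS ONLY (no definition, no instance, no notation, no named fact). The private root-of-unity lemmas of row g43-#5 are re-proved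
here privately (they are not exported there).

## Source, verbatim (held text `paper:doi-10-18910-4811`, pp. 449 and 453)

A. Ikeda, Y. Yamamoto, *On the spectra of 3-dimensional lens spaces*, Osaka J. Math. **16** (1979) 447–469: "**Proposition 1.2** (see J.A.
Wolf [13]). The riemannian manifold `L(q : p₀, ⋯, p_n)` is homogeneous if and only if for any `i` and `j`, `0 ≤ i, j ≤ n`, it satisfies
either `pᵢ ≡ p_j (mod q)` or `pᵢ ≡ −p_j (mod q)`. Furthermore two homogeneous lens spaces with same [order of fundamental groups and
dimension] are isometric to each other" (p0004); "**Corollary 3.4.** Assume `L(q : p₀, ⋯, p_n)` is a homogeneous lens space and isospectral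
to `L(q : p′₀, ⋯, p′_n)`. Then `L(q : p′₀, ⋯, p′_n)` is homogeneous and isometric to `L(q : p₀, ⋯, p_n)`. *Proof.* Let `F(z)` be the
generating function associated to the spectrum of `L(q : p₀, ⋯, p_n)`. Then `F(z)` has a pole of order `(n+1)` or `(2n+1)` at `z` = any `q`-th
root of one if and only if for any `i, j (0 ≤ i, j ≤ n)`, we have either `pᵢ ≡ p_j (mod q)` or `pᵢ ≡ −p_j (mod q)`. By proposition 1.2, this
condition holds if and only if `L(q : p₀, ⋯, p_n)` is homogeneous. By our assumption and Proposition 3.1, the generating function associated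
to the spectrum of `L(q : p′₀, ⋯, p′_n)` has also the same condition as `F(z)` so that `L(q : p′₀, ⋯, p′_n)` is homogeneous. By Proposition 1.2,
this space is isometric to `L(q : p₀, ⋯, p_n)`. q.e.d. REMARK. M. Tanaka [10] obtained Corollary 3.4 for 3-dimensional lens spaces." (p0008).

## The proof as formalised (the pole at the single root of unity `z₀ = γ^{−1}`, `γ = e^{2πi/q}`, `q ≥ 3`)

By (3.8), `F(z) = (1/q)∑_{l<q}T_l(z)`, `T_l(z) = (1 − z²)/∏ᵢ(1 − γ^{lpᵢ}z)(1 − γ^{−lpᵢ}z)`, and `(1 − γz)^{n+1}T_l(z) = (1 − z²)∏ᵢ g_{l,i}(z)` with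
`g_{l,i}(z) = (1 − γz)/((1 − γ^{lpᵢ}z)(1 − γ^{−lpᵢ}z))`. §2: as `z → z₀`, `g_{l,i} → 1/(1 − γ^{−2})` when `lpᵢ ≡ ±1` (one root is `γ`, the
other `γ^{−1} = z₀`; `1 − γ^{−2} ≠ 0` as `q ≥ 3`; both roots cannot be `γ` since `q ∤ 2`), and `g_{l,i} → 0/(non-zero) = 0` otherwise. §3:
hence `(1 − γz)^{n+1}T_l → (1 − γ^{−2})^{−n}` if ALL `lpᵢ ≡ ±1`, else `0`, and `(1 − γz)^{n+1}F(z) → (1/q)·N_p·(1 − γ^{−2})^{−n}`, `N_p = #{l < q :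
∀i, lpᵢ ≡ ±1}`; the same for the power series, `z → z₀` inside the disc. §4: if some `l` has `lpᵢ ≡ ±1 ∀i` then `l` is a unit mod `q` and `pᵢ ≡
±p_j` for all `i, j`; conversely `pᵢ ≡ ±p₀` (`p₀` prime to `q`) gives `l = p₀^{−1} mod q`. §5: so `N_p ≥ 1` (limit `≠ 0`) for homogeneous `p`
and `N_{p′} = 0` (limit `0`) for non-homogeneous `p′`; equal multiplicities give equal series, equal limits — contradiction. For `q ≤ 2`
every weight system is homogeneous (`q = 2`: all weights odd).

## What is proved

* §2 **`tendsto_one_sub_mul_div_quadratic`** (the factor limit, `1/(1 − γ^{−2})` or `0`).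
* §3 **`tendsto_pow_mul_term`**, **`tendsto_pow_mul_lensSpaceGeneratingFunction`** (`(1 − γz)^{n+1}F → (1/q)N_p(1 − γ^{−2})^{−n}`),
  **`tendsto_pow_mul_tsum_lensSpaceMultiplicity_mul_pow`** (the same for the series inside the disc).
* §4 **`dvd_sub_or_dvd_add_of_forall_dvd`** (a top-order pole forces `pᵢ ≡ ±p_j`), **`exists_forall_dvd_of_dvd_sub_or_dvd_add`** (homogeneous
  ⟹ a top-order pole).
* §5 **`tendsto_pow_mul_tsum_lensSpaceMultiplicity_mul_pow_eq_zero`** (non-homogeneous: limit `0`), **`…_ne_zero`** (homogeneous: limit `≠ 0`),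
  **`dvd_sub_or_dvd_add_of_lensSpaceMultiplicity_eq_of_three_le`**, **`dvd_sub_or_dvd_add_of_lensSpaceMultiplicity_eq`** (COROLLARY 3.4, EVERY
  DIMENSION AND EVERY `q`).

## References

* [IkedaYamamoto1979] A. Ikeda, Y. Yamamoto, *On the spectra of 3-dimensional lens spaces*, Osaka J. Math. 16 (1979) 447–469, §1
  Proposition 1.2, §3 Proposition 3.1, Theorem 3.2 (3.8), Corollary 3.4 and its proof (p. 453).
* [Ikeda1980] A. Ikeda, *On lens spaces which are isospectral but not isometric*, Ann. Sci. ÉNS (4) 13 (1980) 303–315, §2 Theorem 2.1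
  (the isometry classification of lens spaces).
-/

noncomputable section

open Finset Filter Topology Complex

namespace Literature.Analysis.InnerProduct

open _root_.Real _root_.Filter _root_.Topology _root_.Polynomial

/-! ### §1 Roots of unity at `z₀ = γ^{−1}`: which factors `1 − γ^{±lp}z` of (3.8) vanish there -/

/-- `0 < N < q ⇒ q ∤ N`. [folklore] -/
private theorem not_dvd_of_pos_of_lt {q : ℕ} {N : ℤ} (h0 : 0 < N) (h1 : N < q) : ¬ (q : ℤ) ∣ N := by
  rintro ⟨c, hc⟩
  rcases le_or_gt c 0 with hc0 | hc0
  · nlinarith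
  · nlinarith

/-- `e^{2πiN/q} = 1 ↔ q ∣ N`. [folklore] -/
private theorem exp_two_pi_mul_I_mul_intCast_div_eq_one_iff {q : ℕ} (hq : q ≠ 0) (N : ℤ) :
    cexp (2 * π * I * N / q) = 1 ↔ (q : ℤ) ∣ N := by
  have hq0 : (q : ℂ) ≠ 0 := Nat.cast_ne_zero.mpr hq
  have h2 : (2 * π * I : ℂ) ≠ 0 := by simp [Real.pi_ne_zero, I_ne_zero]
  constructor
  · intro h
    obtain ⟨n, hn⟩ := Complex.exp_eq_one_iff.mp h
    have h3 := congrArg (· * (q : ℂ)) hn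
    simp only [div_mul_cancel₀ _ hq0] at h3
    have h4 : (2 * π * I) * (N : ℂ) = (2 * π * I) * (n * q) := by linear_combination h3
    have h5 := mul_left_cancel₀ h2 h4
    exact ⟨n, by exact_mod_cast h5.trans (mul_comm _ _)⟩
  · rintro ⟨c, hc⟩
    rw [hc, show (2 * π * I * ((q * c : ℤ) : ℂ) / q) = c * (2 * π * I) by push_cast; field_simp]
    exact Complex.exp_int_mul_two_pi_mul_I c

/-- `γ^{lp}·γ^{−1} = 1 ↔ q ∣ lp − 1`. [folklore] -/
private theorem exp_mul_exp_neg_eq_one_iff {q : ℕ} (hq : q ≠ 0) (l : ℕ) (p : ℤ) :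
    cexp (2 * π * I * l * p / q) * cexp (-(2 * π * I / q)) = 1 ↔ (q : ℤ) ∣ l * p - 1 := by
  rw [← Complex.exp_add, show 2 * π * I * (l : ℂ) * (p : ℂ) / q + -(2 * π * I / q) =
    2 * π * I * ((((l : ℤ) * p - 1 : ℤ)) : ℂ) / q by push_cast; ring]
  exact exp_two_pi_mul_I_mul_intCast_div_eq_one_iff hq _

/-- `γ^{−lp}·γ^{−1} = 1 ↔ q ∣ −lp − 1`. [folklore] -/
private theorem exp_neg_mul_exp_neg_eq_one_iff {q : ℕ} (hq : q ≠ 0) (l : ℕ) (p : ℤ) :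
    cexp (-(2 * π * I * l * p / q)) * cexp (-(2 * π * I / q)) = 1 ↔ (q : ℤ) ∣ -(l * p) - 1 := by
  rw [← Complex.exp_add, show -(2 * π * I * (l : ℂ) * (p : ℂ) / q) + -(2 * π * I / q) =
    2 * π * I * (((-((l : ℤ) * p) - 1 : ℤ)) : ℂ) / q by push_cast; ring]
  exact exp_two_pi_mul_I_mul_intCast_div_eq_one_iff hq _

/-- `γ·γ^{−1} = 1`. [folklore] -/
private theorem exp_mul_exp_neg_self (q : ℕ) : cexp (2 * π * I / q) * cexp (-(2 * π * I / q)) = 1 := by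
  rw [← Complex.exp_add, add_neg_cancel, Complex.exp_zero]

/-- `γ^{lp}·γ^{−lp} = 1`. [folklore] -/
private theorem exp_mul_exp_neg_self' (q l : ℕ) (p : ℤ) :
    cexp (2 * π * I * l * p / q) * cexp (-(2 * π * I * l * p / q)) = 1 := by
  rw [← Complex.exp_add, add_neg_cancel, Complex.exp_zero]

/-- If `ωz₀ = 1 = γz₀` then `ω = γ`. [folklore] -/
private theorem eq_of_mul_eq_one_of_mul_eq_one {ω γ z₀ : ℂ} (hω : ω * z₀ = 1) (hγ : γ * z₀ = 1) : ω = γ := by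
  have hz : z₀ ≠ 0 := by
    rintro rfl
    simp at hγ
  exact mul_right_cancel₀ hz (hω.trans hγ.symm)

/-- If `ω₁ω₂ = 1`, `γz₀ = 1` and `ω₁ = γ` then `ω₂ = z₀`. [folklore] -/
private theorem eq_of_inv_pair {ω₁ ω₂ γ z₀ : ℂ} (hω : ω₁ * ω₂ = 1) (hγ : γ * z₀ = 1) (h : ω₁ = γ) : ω₂ = z₀ := by
  subst h
  have h0 : ω₁ ≠ 0 := by
    rintro rfl
    simp at hγ
  exact mul_left_cancel₀ h0 (hω.trans hγ.symm)

/-- `γz₀ = 1`, `z ≠ z₀ ⇒ 1 − γz ≠ 0`. [folklore] -/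
private theorem one_sub_mul_ne_zero_of_ne {γ z₀ z : ℂ} (hγ : γ * z₀ = 1) (hz : z ≠ z₀) : 1 - γ * z ≠ 0 := by
  intro h
  apply hz
  have hγ0 : γ ≠ 0 := by
    rintro rfl
    simp at hγ
  exact mul_left_cancel₀ hγ0 ((sub_eq_zero.mp h).symm.trans hγ.symm)

/-- `1 − γ^{−2} ≠ 0` for `q ≥ 3`. [folklore] -/
private theorem one_sub_exp_neg_sq_ne_zero {q : ℕ} (hq : 3 ≤ q) : 1 - cexp (-(2 * π * I / q)) ^ 2 ≠ 0 := by
  have hq0 : q ≠ 0 := by omega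
  intro h
  have h1 : cexp (-(2 * π * I / q)) ^ 2 = 1 := (sub_eq_zero.mp h).symm
  rw [sq, ← Complex.exp_add, show -(2 * π * I / (q : ℂ)) + -(2 * π * I / q) = 2 * π * I * ((-2 : ℤ) : ℂ) / q by
    push_cast; ring, exp_two_pi_mul_I_mul_intCast_div_eq_one_iff hq0, dvd_neg] at h1
  exact not_dvd_of_pos_of_lt two_pos (by omega) h1

/-! ### §2 The factor `(1 − γz)/((1 − γ^{lp}z)(1 − γ^{−lp}z))` at `z → γ^{−1}`: `→ 1/(1 − γ^{−2})` if `lp ≡ ±1`, else `→ 0` -/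

/-- **One factor of a term of (3.8) at `z₀ = γ^{−1}`, `γ = e^{2πi/q}`, `q ≥ 3`**: `(1 − γz)/((1 − γ^{lp}z)(1 − γ^{−lp}z)) →
1/(1 − γ^{−2})` as `z → z₀` (`z ≠ z₀`) if `lp ≡ 1` or `lp ≡ −1 (mod q)` (then the other root is `γ^{∓1}` and `1 − γ^{∓lp}z₀ = 1 − γ^{−2}`),
and `→ 0` otherwise (no factor vanishes at `z₀`, the numerator does). [cite: IkedaYamamoto1979, proof of Corollary 3.4 (p. 453: "`F(z)`
has a pole of order `(n+1)` or `(2n+1)` at `z` = any `q`-th root of one if and only if … `pᵢ ≡ p_j (mod q)` or `pᵢ ≡ −p_j (mod q)`")] -/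
theorem tendsto_one_sub_mul_div_quadratic {q : ℕ} (hq : 3 ≤ q) (l : ℕ) (p : ℤ) :
    Tendsto (fun z : ℂ ↦ (1 - cexp (2 * π * I / q) * z) /
        ((1 - cexp (2 * π * I * l * p / q) * z) * (1 - cexp (-(2 * π * I * l * p / q)) * z)))
      (𝓝[≠] (cexp (-(2 * π * I / q))))
      (𝓝 (if (q : ℤ) ∣ l * p - 1 ∨ (q : ℤ) ∣ -(l * p) - 1 then (1 - cexp (-(2 * π * I / q)) ^ 2)⁻¹ else 0)) := by
  have hq0 : q ≠ 0 := by omega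
  have hq2 : ¬ (q : ℤ) ∣ 2 := not_dvd_of_pos_of_lt two_pos (by omega)
  have hγ := exp_mul_exp_neg_self q
  have hω := exp_mul_exp_neg_self' q l p
  have k1 := exp_mul_exp_neg_eq_one_iff hq0 l p
  have k2 := exp_neg_mul_exp_neg_eq_one_iff hq0 l p
  set ω₁ : ℂ := cexp (2 * π * I * l * p / q) with hω₁
  set ω₂ : ℂ := cexp (-(2 * π * I * l * p / q)) with hω₂
  set γ : ℂ := cexp (2 * π * I / q) with hγdef
  set z₀ : ℂ := cexp (-(2 * π * I / q)) with hz₀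
  have x12 : (q : ℤ) ∣ l * p - 1 → ¬ (q : ℤ) ∣ -(l * p) - 1 := fun h1 h2 ↦ hq2 (by
    have := dvd_add h1 h2; rw [show (l : ℤ) * p - 1 + (-(l * p) - 1) = -2 by ring, dvd_neg] at this; exact this)
  by_cases c1 : ω₁ * z₀ = 1
  · have d1 := k1.mp c1
    rw [if_pos (Or.inl d1)]
    have e1 : ω₁ = γ := eq_of_mul_eq_one_of_mul_eq_one c1 hγ
    have e2 : ω₂ = z₀ := eq_of_inv_pair hω hγ e1
    have n2 : 1 - ω₂ * z₀ ≠ 0 := by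
      rw [e2, ← sq]
      exact one_sub_exp_neg_sq_ne_zero hq
    have hc : Tendsto (fun z : ℂ ↦ (1 - ω₂ * z)⁻¹) (𝓝 z₀) (𝓝 (1 - ω₂ * z₀)⁻¹) :=
      ((continuous_const.sub (continuous_const.mul continuous_id)).continuousAt.tendsto).inv₀ n2
    rw [show (1 - z₀ ^ 2)⁻¹ = (1 - ω₂ * z₀)⁻¹ by rw [e2, sq]]
    refine (hc.mono_left nhdsWithin_le_nhds).congr' ?_
    filter_upwards [self_mem_nhdsWithin] with z hz
    have hz' := one_sub_mul_ne_zero_of_ne hγ hz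
    rw [e1, div_mul_eq_div_div, div_self hz', one_div]
  by_cases c2 : ω₂ * z₀ = 1
  · have d2 := k2.mp c2
    rw [if_pos (Or.inr d2)]
    have e2 : ω₂ = γ := eq_of_mul_eq_one_of_mul_eq_one c2 hγ
    have e1 : ω₁ = z₀ := eq_of_inv_pair (by rw [mul_comm]; exact hω) hγ e2
    have n1 : 1 - ω₁ * z₀ ≠ 0 := by
      rw [e1, ← sq]
      exact one_sub_exp_neg_sq_ne_zero hq
    have hc : Tendsto (fun z : ℂ ↦ (1 - ω₁ * z)⁻¹) (𝓝 z₀) (𝓝 (1 - ω₁ * z₀)⁻¹) :=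
      ((continuous_const.sub (continuous_const.mul continuous_id)).continuousAt.tendsto).inv₀ n1
    rw [show (1 - z₀ ^ 2)⁻¹ = (1 - ω₁ * z₀)⁻¹ by rw [e1, sq]]
    refine (hc.mono_left nhdsWithin_le_nhds).congr' ?_
    filter_upwards [self_mem_nhdsWithin] with z hz
    have hz' := one_sub_mul_ne_zero_of_ne hγ hz
    rw [e2, div_mul_eq_div_div_swap, div_self hz', one_div]
  · have n : ¬ ((q : ℤ) ∣ l * p - 1 ∨ (q : ℤ) ∣ -(l * p) - 1) := not_or.mpr ⟨fun h ↦ c1 (k1.mpr h), fun h ↦ c2 (k2.mpr h)⟩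
    rw [if_neg n]
    have hc : Tendsto (fun z : ℂ ↦ (1 - γ * z) / ((1 - ω₁ * z) * (1 - ω₂ * z))) (𝓝 z₀)
        (𝓝 ((1 - γ * z₀) / ((1 - ω₁ * z₀) * (1 - ω₂ * z₀)))) :=
      ((continuous_const.sub (continuous_const.mul continuous_id)).continuousAt.tendsto).div
        (((continuous_const.sub (continuous_const.mul continuous_id)).mul
          (continuous_const.sub (continuous_const.mul continuous_id))).continuousAt.tendsto)
        (mul_ne_zero (sub_ne_zero.mpr (Ne.symm c1)) (sub_ne_zero.mpr (Ne.symm c2)))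
    rw [hγ, sub_self, zero_div] at hc
    exact hc.mono_left nhdsWithin_le_nhds

/-! ### §3 The terms and the sum of (3.8) multiplied by `(1 − γz)^{n+1}`, at `z → γ^{−1}` -/

/-- **A term of (3.8) times `(1 − γz)^{n+1}` at `z → γ^{−1}`**: `(1 − γz)^{n+1}(1 − z²)/∏ᵢ(1 − γ^{lpᵢ}z)(1 − γ^{−lpᵢ}z) = (1 −
z²)∏ᵢ[(1 − γz)/((1 − γ^{lpᵢ}z)(1 − γ^{−lpᵢ}z))] → (1 − γ^{−2})·∏ᵢ(1/(1 − γ^{−2}) if lpᵢ ≡ ±1 else 0)`: a pole of order EXACTLY `n+1`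
at `γ^{−1}` iff every `lpᵢ ≡ ±1 (mod q)`. [cite: IkedaYamamoto1979, proof of Corollary 3.4] -/
theorem tendsto_pow_mul_term {q : ℕ} (hq : 3 ≤ q) (l : ℕ) {n : ℕ} (p : Fin (n + 1) → ℤ) :
    Tendsto (fun z : ℂ ↦ (1 - cexp (2 * π * I / q) * z) ^ (n + 1) * ((1 - z ^ 2) /
        ∏ i, ((1 - cexp (2 * π * I * l * p i / q) * z) * (1 - cexp (-(2 * π * I * l * p i / q)) * z))))
      (𝓝[≠] (cexp (-(2 * π * I / q))))
      (𝓝 ((1 - cexp (-(2 * π * I / q)) ^ 2) * ∏ i : Fin (n + 1),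
        (if (q : ℤ) ∣ l * p i - 1 ∨ (q : ℤ) ∣ -(l * p i) - 1 then (1 - cexp (-(2 * π * I / q)) ^ 2)⁻¹ else 0))) := by
  have h1 : Tendsto (fun z : ℂ ↦ 1 - z ^ 2) (𝓝[≠] (cexp (-(2 * π * I / q)))) (𝓝 (1 - cexp (-(2 * π * I / q)) ^ 2)) :=
    ((continuous_const.sub (continuous_id.pow 2)).continuousAt.tendsto).mono_left nhdsWithin_le_nhds
  have h2 := tendsto_finsetProd (univ : Finset (Fin (n + 1))) fun i _ ↦ tendsto_one_sub_mul_div_quadratic hq l (p i)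
  refine (h1.mul h2).congr' ?_
  filter_upwards with z
  rw [Finset.prod_div_distrib, Finset.prod_const, card_univ, Fintype.card_fin]
  ring

/-- `c·∏ᵢ(if Pᵢ then c⁻¹ else 0) = (if ∀ i, Pᵢ then c·(c⁻¹)^{n+1} else 0)`. [folklore] -/
private theorem prod_ite_inv_eq {n : ℕ} {c : ℂ} (P : Fin (n + 1) → Prop) [DecidablePred P] :
    c * ∏ i : Fin (n + 1), (if P i then c⁻¹ else 0) = if ∀ i, P i then c * (c⁻¹) ^ (n + 1) else 0 := by
  rw [Finset.prod_ite_zero]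
  simp only [Finset.mem_univ, true_implies, Finset.prod_const, card_univ, Fintype.card_fin]
  split_ifs <;> simp

/-- **`(1 − γz)^{n+1}F(z)` at `z → γ^{−1}` for the closed form (3.8) of `L(q : p₀, …, p_n)`, `q ≥ 3`**: the limit is
`(1/q)·#{l < q : lpᵢ ≡ ±1 (mod q) for all i}·(1 − γ^{−2})^{−n}` — the coefficient of the pole of order `n+1` at the `q`-th root of
unity `γ^{−1}`. [cite: IkedaYamamoto1979, Theorem 3.2 (3.8) and proof of Corollary 3.4] -/
theorem tendsto_pow_mul_lensSpaceGeneratingFunction {q : ℕ} (hq : 3 ≤ q) {n : ℕ} (p : Fin (n + 1) → ℤ) :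
    Tendsto (fun z : ℂ ↦ (1 - cexp (2 * π * I / q) * z) ^ (n + 1) * (1 / (q : ℂ) * ∑ l ∈ range q, (1 - z ^ 2) /
        ∏ i, ((1 - cexp (2 * π * I * l * p i / q) * z) * (1 - cexp (-(2 * π * I * l * p i / q)) * z))))
      (𝓝[≠] (cexp (-(2 * π * I / q))))
      (𝓝 (1 / (q : ℂ) * ∑ l ∈ range q, (if ∀ i, ((q : ℤ) ∣ l * p i - 1 ∨ (q : ℤ) ∣ -(l * p i) - 1) then
        (1 - cexp (-(2 * π * I / q)) ^ 2) * ((1 - cexp (-(2 * π * I / q)) ^ 2)⁻¹) ^ (n + 1) else 0))) := by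
  have h := tendsto_finsetSum (range q) fun l (_ : l ∈ range q) ↦ tendsto_pow_mul_term hq l p
  simp only [prod_ite_inv_eq] at h
  refine ((h.const_mul (1 / (q : ℂ))).congr fun z ↦ ?_)
  rw [Finset.mul_sum, Finset.mul_sum, Finset.mul_sum]
  exact Finset.sum_congr rfl fun l _ ↦ by ring

/-- `|γ^{−1}| = 1`. [folklore] -/
private theorem norm_exp_neg_two_pi_mul_I_div (q : ℕ) : ‖cexp (-(2 * π * I / q))‖ = 1 := by
  rw [show -(2 * π * I / (q : ℂ)) = ((-(2 * π / q) : ℝ) : ℂ) * I by push_cast; ring, Complex.norm_exp_ofReal_mul_I]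

/-- `𝓝[ball 0 1] z₀ ≤ 𝓝[≠] z₀` and `𝓝[ball 0 1] z₀` is nontrivial, for `|z₀| = 1`. [folklore] -/
private theorem nhdsWithin_ball_le_and_neBot {z₀ : ℂ} (hz₀ : ‖z₀‖ = 1) :
    𝓝[Metric.ball (0 : ℂ) 1] z₀ ≤ 𝓝[≠] z₀ ∧ (𝓝[Metric.ball (0 : ℂ) 1] z₀).NeBot := by
  refine ⟨nhdsWithin_mono _ fun z hz (h1 : z = z₀) ↦ ?_, mem_closure_iff_nhdsWithin_neBot.mp ?_⟩
  · rw [h1, mem_ball_zero_iff, hz₀] at hz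
    exact lt_irrefl _ hz
  · rw [closure_ball (0 : ℂ) one_ne_zero, Metric.mem_closedBall, dist_zero_right, hz₀]

/-- **The same limit for the power series `∑_k dim E_{k(k+2n)}z^k` itself**, `z → γ^{−1}` inside the unit disc (where it converges to
(3.8), `HigherLensSpaceGeneratingFunction.tsum_lensSpaceMultiplicity_mul_pow`). [cite: IkedaYamamoto1979, Theorem 3.2, proof of
Corollary 3.4] -/
theorem tendsto_pow_mul_tsum_lensSpaceMultiplicity_mul_pow {q : ℕ} (hq : 3 ≤ q) {n : ℕ} (p : Fin (n + 1) → ℤ) :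
    Tendsto (fun z : ℂ ↦ (1 - cexp (2 * π * I / q) * z) ^ (n + 1) * ∑' k : ℕ, (lensSpaceMultiplicity q p k : ℂ) * z ^ k)
      (𝓝[Metric.ball 0 1] (cexp (-(2 * π * I / q))))
      (𝓝 (1 / (q : ℂ) * ∑ l ∈ range q, (if ∀ i, ((q : ℤ) ∣ l * p i - 1 ∨ (q : ℤ) ∣ -(l * p i) - 1) then
        (1 - cexp (-(2 * π * I / q)) ^ 2) * ((1 - cexp (-(2 * π * I / q)) ^ 2)⁻¹) ^ (n + 1) else 0))) := by
  have hq0 : q ≠ 0 := by omega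
  obtain ⟨hle, _⟩ := nhdsWithin_ball_le_and_neBot (norm_exp_neg_two_pi_mul_I_div q)
  refine ((tendsto_pow_mul_lensSpaceGeneratingFunction hq p).mono_left hle).congr' ?_
  filter_upwards [self_mem_nhdsWithin] with z hz
  rw [tsum_lensSpaceMultiplicity_mul_pow q hq0 p (mem_ball_zero_iff.mp hz)]

/-! ### §4 The arithmetic of the top-order poles at `γ^{−1}`: some `l` has all `lpᵢ ≡ ±1` iff the weights are pairwise `≡ ±` -/

/-- **If some `l` has `lpᵢ ≡ ±1 (mod q)` for every `i`, then `pᵢ ≡ ±p_j (mod q)` for all `i, j`** (`l` is then a unit mod `q`):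
the top-order pole occurs only for homogeneous weight systems. [cite: IkedaYamamoto1979, proof of Corollary 3.4 with Proposition 1.2] -/
theorem dvd_sub_or_dvd_add_of_forall_dvd {q : ℕ} {n : ℕ} {p : Fin (n + 1) → ℤ} {l : ℕ}
    (hl : ∀ i, (q : ℤ) ∣ l * p i - 1 ∨ (q : ℤ) ∣ -(l * p i) - 1) (i j : Fin (n + 1)) :
    (q : ℤ) ∣ p i - p j ∨ (q : ℤ) ∣ p i + p j := by
  have hcop : IsCoprime (l : ℤ) q := by
    rcases hl i with ⟨m, hm⟩ | ⟨m, hm⟩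
    · exact ⟨p i, -m, by linear_combination hm⟩
    · exact ⟨-p i, -m, by linear_combination hm⟩
  rcases hl i with hi | hi <;> rcases hl j with hj | hj
  · left
    refine hcop.symm.dvd_of_dvd_mul_left ?_
    have := dvd_sub hi hj
    rwa [show (l : ℤ) * p i - 1 - (l * p j - 1) = l * (p i - p j) by ring] at this
  · right
    refine hcop.symm.dvd_of_dvd_mul_left ?_
    have := dvd_sub hi hj
    rwa [show (l : ℤ) * p i - 1 - (-(l * p j) - 1) = l * (p i + p j) by ring] at this
  · right
    refine hcop.symm.dvd_of_dvd_mul_left ?_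
    have := dvd_sub hj hi
    rwa [show (l : ℤ) * p j - 1 - (-(l * p i) - 1) = l * (p i + p j) by ring] at this
  · left
    refine hcop.symm.dvd_of_dvd_mul_left ?_
    have := dvd_sub hj hi
    rwa [show -((l : ℤ) * p j) - 1 - (-(l * p i) - 1) = l * (p i - p j) by ring] at this

/-- **Conversely, a homogeneous weight system (`pᵢ ≡ ±p₀`, `p₀` prime to `q`) has such an `l < q`**: `l ≡ p₀^{−1} (mod q)`.
[cite: IkedaYamamoto1979, proof of Corollary 3.4 with Proposition 1.2] -/
theorem exists_forall_dvd_of_dvd_sub_or_dvd_add {q : ℕ} (hq : q ≠ 0) {n : ℕ} {p : Fin (n + 1) → ℤ}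
    (hp : IsCoprime (p 0) q) (hhom : ∀ i, (q : ℤ) ∣ p i - p 0 ∨ (q : ℤ) ∣ p i + p 0) :
    ∃ l ∈ range q, ∀ i, (q : ℤ) ∣ l * p i - 1 ∨ (q : ℤ) ∣ -(l * p i) - 1 := by
  obtain ⟨u, v, huv⟩ := hp
  have hq0 : (0 : ℤ) < q := by exact_mod_cast Nat.pos_of_ne_zero hq
  refine ⟨(u % q).toNat, ?_, fun i ↦ ?_⟩
  · rw [mem_range]
    have h1 : u % q < q := Int.emod_lt_of_pos u hq0
    have h0 : 0 ≤ u % q := Int.emod_nonneg u hq0.ne'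
    omega
  · have hl : (((u % q).toNat : ℕ) : ℤ) = u % q := Int.toNat_of_nonneg (Int.emod_nonneg u hq0.ne')
    rw [hl]
    have hu : (q : ℤ) ∣ u % q * p 0 - 1 := by
      have e : u % q * p 0 - 1 = -(v + (u / q) * p 0) * q := by
        have := Int.emod_add_mul_ediv u q
        linear_combination huv + p 0 * this
      exact ⟨-(v + u / q * p 0), by rw [e]; ring⟩
    rcases hhom i with h | h
    · left
      have := dvd_add hu (dvd_mul_of_dvd_right h (u % q))
      rwa [show u % q * p 0 - 1 + u % q * (p i - p 0) = u % q * p i - 1 by ring] at this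
    · right
      have := dvd_sub (dvd_mul_of_dvd_right h (u % q)) hu
      rwa [show u % q * (p i + p 0) - (u % q * p 0 - 1) = -(-(u % q * p i) - 1) by ring, dvd_neg] at this

/-! ### §5 Corollary 3.4: a homogeneous lens space is determined by its spectrum among lens spaces -/

/-- **A NON-homogeneous lens space has a pole of order `≤ n` at `γ^{−1}`**: if `pᵢ ≢ ±p_j (mod q)` for some `i, j` then
`(1 − γz)^{n+1}∑_k dim E_{k(k+2n)}(L(q : p))z^k → 0` as `z → γ^{−1}` inside the disc (`q ≥ 3`). [cite: IkedaYamamoto1979, proof of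
Corollary 3.4] -/
theorem tendsto_pow_mul_tsum_lensSpaceMultiplicity_mul_pow_eq_zero {q : ℕ} (hq : 3 ≤ q) {n : ℕ} {p : Fin (n + 1) → ℤ}
    {i j : Fin (n + 1)} (hij : ¬ (q : ℤ) ∣ p i - p j) (hij' : ¬ (q : ℤ) ∣ p i + p j) :
    Tendsto (fun z : ℂ ↦ (1 - cexp (2 * π * I / q) * z) ^ (n + 1) * ∑' k : ℕ, (lensSpaceMultiplicity q p k : ℂ) * z ^ k)
      (𝓝[Metric.ball 0 1] (cexp (-(2 * π * I / q)))) (𝓝 0) := by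
  have h := tendsto_pow_mul_tsum_lensSpaceMultiplicity_mul_pow hq p
  have hz : ∀ l ∈ range q, (if ∀ i, ((q : ℤ) ∣ l * p i - 1 ∨ (q : ℤ) ∣ -(l * p i) - 1) then
      (1 - cexp (-(2 * π * I / q)) ^ 2) * ((1 - cexp (-(2 * π * I / q)) ^ 2)⁻¹) ^ (n + 1) else (0 : ℂ)) = 0 := by
    intro l _
    rw [if_neg]
    intro hl
    rcases dvd_sub_or_dvd_add_of_forall_dvd hl i j with h' | h'
    · exact hij h'
    · exact hij' h'
  rwa [Finset.sum_congr rfl hz, Finset.sum_const_zero, mul_zero] at h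

/-- **A HOMOGENEOUS lens space has a pole of order exactly `n+1` at `γ^{−1}`**: for `pᵢ ≡ ±p₀ (mod q)`, `p₀` prime to `q`, `q ≥ 3`,
the limit `(1/q)∑_l[lpᵢ ≡ ±1 ∀i](1 − γ^{−2})^{−n}` of `(1 − γz)^{n+1}F(z)` is non-zero. [cite: IkedaYamamoto1979, proof of Corollary 3.4 ("a
pole of order `(n+1)` … at any `q`-th root of one")] -/
theorem tendsto_pow_mul_tsum_lensSpaceMultiplicity_mul_pow_ne_zero {q : ℕ} (hq : 3 ≤ q) {n : ℕ} {p : Fin (n + 1) → ℤ}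
    (hp : IsCoprime (p 0) q) (hhom : ∀ i, (q : ℤ) ∣ p i - p 0 ∨ (q : ℤ) ∣ p i + p 0) :
    (1 / (q : ℂ) * ∑ l ∈ range q, (if ∀ i, ((q : ℤ) ∣ l * p i - 1 ∨ (q : ℤ) ∣ -(l * p i) - 1) then
        (1 - cexp (-(2 * π * I / q)) ^ 2) * ((1 - cexp (-(2 * π * I / q)) ^ 2)⁻¹) ^ (n + 1) else (0 : ℂ))) ≠ 0 := by
  have hq0 : q ≠ 0 := by omega
  have hV := one_sub_exp_neg_sq_ne_zero hq
  have hC : (1 - cexp (-(2 * π * I / q)) ^ 2) * ((1 - cexp (-(2 * π * I / q)) ^ 2)⁻¹) ^ (n + 1) ≠ 0 :=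
    mul_ne_zero hV (pow_ne_zero _ (inv_ne_zero hV))
  obtain ⟨l₀, hl₀, hfull⟩ := exists_forall_dvd_of_dvd_sub_or_dvd_add hq0 hp hhom
  refine mul_ne_zero (div_ne_zero one_ne_zero (Nat.cast_ne_zero.mpr hq0)) ?_
  rw [← Finset.sum_filter, Finset.sum_const, nsmul_eq_mul]
  refine mul_ne_zero ?_ hC
  have hmem : l₀ ∈ (range q).filter (fun l : ℕ ↦ ∀ i, ((q : ℤ) ∣ (l : ℤ) * p i - 1 ∨ (q : ℤ) ∣ -((l : ℤ) * p i) - 1)) :=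
    Finset.mem_filter.mpr ⟨hl₀, hfull⟩
  exact Nat.cast_ne_zero.mpr (Finset.card_pos.mpr ⟨l₀, hmem⟩).ne'

/-- **COROLLARY 3.4, `q ≥ 3`, EVERY DIMENSION**: if `L(q : p₀, …, p_n)` is homogeneous (`pᵢ ≡ ±p₀ (mod q)`, Proposition 1.2) and
`L(q : p′₀, …, p′_n)` has the same multiplicities `dim E_{k(k+2n)}` for all `k`, then `p′ᵢ ≡ ±p′_j (mod q)` for all `i, j` — `L(q : p′)` is
homogeneous (and then, by Proposition 1.2, isometric to `L(q : p)`). [cite: IkedaYamamoto1979, Corollary 3.4 and Proposition 1.2] -/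
theorem dvd_sub_or_dvd_add_of_lensSpaceMultiplicity_eq_of_three_le {q : ℕ} (hq : 3 ≤ q) {n : ℕ} {p p' : Fin (n + 1) → ℤ}
    (hp : IsCoprime (p 0) q) (hhom : ∀ i, (q : ℤ) ∣ p i - p 0 ∨ (q : ℤ) ∣ p i + p 0)
    (h : ∀ k : ℕ, lensSpaceMultiplicity q p k = lensSpaceMultiplicity q p' k) (i j : Fin (n + 1)) :
    (q : ℤ) ∣ p' i - p' j ∨ (q : ℤ) ∣ p' i + p' j := by
  by_contra hne
  rw [not_or] at hne
  have h1 := tendsto_pow_mul_tsum_lensSpaceMultiplicity_mul_pow hq p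
  have h2 := tendsto_pow_mul_tsum_lensSpaceMultiplicity_mul_pow_eq_zero hq hne.1 hne.2
  simp only [← h] at h2
  haveI := (nhdsWithin_ball_le_and_neBot (norm_exp_neg_two_pi_mul_I_div q)).2
  exact tendsto_pow_mul_tsum_lensSpaceMultiplicity_mul_pow_ne_zero hq hp hhom (tendsto_nhds_unique h1 h2)

/-- **COROLLARY 3.4 (Ikeda–Yamamoto 1979), EVERY DIMENSION AND EVERY `q`**: "Assume `L(q : p₀, ⋯, p_n)` is a homogeneous lens space and
isospectral to `L(q : p′₀, ⋯, p′_n)`. Then `L(q : p′₀, ⋯, p′_n)` is homogeneous and isometric to `L(q : p₀, ⋯, p_n)`", in arithmetic form via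
Proposition 1.2 ("`L(q : p₀, ⋯, p_n)` is homogeneous if and only if for any `i` and `j`, `0 ≤ i, j ≤ n`, it satisfies either `pᵢ ≡ p_j (mod q)`
or `pᵢ ≡ −p_j (mod q)`. Furthermore two homogeneous lens spaces with same [`q`] are isometric"): if `pᵢ ≡ ±p_j` for all `i, j` and the lens
space `L(q : p′)` (weights prime to `q`) has `dim E_k(L(q : p′)) = dim E_k(L(q : p))` for every `k`, then `p′ᵢ ≡ ±p′_j` for all `i, j` (for
`q ≤ 2` every lens space is homogeneous). The tree's `dvd_sub_or_dvd_add_of_lensMultiplicity_eq` is the case `n + 1 = 2`. [cite: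
IkedaYamamoto1979, Corollary 3.4, Proposition 1.2; proof p. 453] -/
theorem dvd_sub_or_dvd_add_of_lensSpaceMultiplicity_eq {q : ℕ} {n : ℕ} {p p' : Fin (n + 1) → ℤ}
    (hp : ∀ i, IsCoprime (p i) q) (hp' : ∀ i, IsCoprime (p' i) q) (hhom : ∀ i j, (q : ℤ) ∣ p i - p j ∨ (q : ℤ) ∣ p i + p j)
    (h : ∀ k : ℕ, lensSpaceMultiplicity q p k = lensSpaceMultiplicity q p' k) (i j : Fin (n + 1)) :
    (q : ℤ) ∣ p' i - p' j ∨ (q : ℤ) ∣ p' i + p' j := by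
  rcases Nat.lt_or_ge q 3 with hq | hq
  · interval_cases q
    · -- `q = 0`: `IsCoprime p 0` forces `p = ±1`
      have h1 := Int.isUnit_iff.mp (isCoprime_zero_right.mp (by simpa using hp' i))
      have h2 := Int.isUnit_iff.mp (isCoprime_zero_right.mp (by simpa using hp' j))
      rcases h1 with h1 | h1 <;> rcases h2 with h2 | h2 <;> simp [h1, h2]
    · exact Or.inl (by simp)
    · -- `q = 2`: both weights are odd
      left
      have hodd : ∀ {r : ℤ}, IsCoprime r (2 : ℕ) → Odd r := fun {r} hr ↦ by
        rw [← Int.not_even_iff_odd, even_iff_two_dvd]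
        intro h2
        have hu : IsUnit (2 : ℤ) := hr.isUnit_of_dvd' h2 (by norm_num)
        rw [Int.isUnit_iff] at hu
        omega
      obtain ⟨a, ha⟩ := hodd (hp' i)
      obtain ⟨b, hb⟩ := hodd (hp' j)
      exact ⟨a - b, by rw [ha, hb]; push_cast; ring⟩
  · exact dvd_sub_or_dvd_add_of_lensSpaceMultiplicity_eq_of_three_le hq (hp 0) (fun i ↦ hhom i 0) h i j

end Literature.Analysis.InnerProduct
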